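/-
COR-CM (cell pub-hodgecm2, stage 2 of the Hodge ladder) — Δ2 BRIDGE, X1 (J) pin, piece **(J2) «ALBANESE ON COMPONENTS»**, LAW (v′)
(the J3 ⇄ J2 interface asked by d2bridge-prove-3, pub-hodgecm2/INBOX l. 10873): the family `albDesc a (inj c) (𝒥 c) :
J(Y_c) ⟶ Alb_X ⊗ ℂ` of `CorCM/D2Bridge/AlbaneseOnPieceCore.lean` DETECTS every non-zero `k`-RATIONAL homomorphism
`f : Alb_X → B` — `∃ c, albDesc_c ≫ f_ℂ ≠ 0` — which is the case `w = f_ℂ`, `f ∈ Hom_E(A_K, A_μ)`, that [Liu2021] Thm. 4.18 (1)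
and the bridge's `hfaith` use.  PROOF FROM Def. 2.3 OVER `k` (uniqueness) + faithfulness of base change — NO descent of abelian
varieties, NO named fact — MODULO the covering hypothesis `hcover` («the pieces `Y_c × Y_c` cover `(∇X)_ℂ`», Liu's
«`(∇X)_{k'} ≃ ∇_{k'}X'`», l. 1199), discharged separately.  Provisional fifth hand own-crow g92 (prover-pub-hodgecm-own-crow-g92-0)
for the SEAT ASK d2bridge-prove-5 (pub-hodgecm2 OPS-REQUESTS l. 377).  THEOREMS ONLY; Literature-only imports besides the core;
no manifest path; nothing landed is edited or restated.  FRAMING: HC_CM is NOT proved; «Δ2 BRIDGE CLOSED» is NOT claimed.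
-/
import Summits.HodgeConjecture.CorCM.D2Bridge.AlbaneseOnPieceCore
import Literature.NumberTheory.Automorphic.Liu2021.NablaOfPieces
import Literature.AlgebraicGeometry.Motives.AbelianVarietyBaseChangeFaithful
import Mathlib.AlgebraicGeometry.Limits
import HarnessLib

/-!
# Δ2 bridge, (J2) LAW (v′): `α` on the pieces detects non-zero `k`-rational homomorphisms out of `Alb_X`

[Liu2021] Y. Liu, arXiv:2102.11518 = Camb. J. Math. 9 (2021): Def. 2.3 with the Proposition (l. 1190–1208: `α_X : ∇X → Alb_X`
corepresents — in particular two homomorphisms `Alb_X → A` agreeing after `α_X` are equal, `AppendixC.Albanese.hom_ext`);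
proof of the Proposition l. 1194–1200 («`∇_{k'}X'`» of the split scheme is `∐ X_i × X_i`); Thm. 4.18 (1) l. 2239 (the
`E`-RATIONAL Hom group `Hom_E(A_K, A_μ)_ℚ`).

For `a : AppendixC.Albanese X`, a colimit cofan `inj c : Y_c ⟶ X ⊗_k ℂ` of geometrically irreducible pieces and Jacobians `𝒥 c`:
* `isOpenImmersion_nablaLiftPiece_left`, `disjoint_range_nablaLiftPiece`, `nonempty_isColimit_nablaLiftPiece` — the lifts
  `Y_c × Y_c ⟶ (∇X)_ℂ` of the core are open immersions with pairwise disjoint images, hence (given that they COVER) a coproduct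
  decomposition of `(∇X)_ℂ` (Mathlib `nonempty_isColimit_cofanMk_of`);
* **`albDesc_comp_baseChange_ne_zero_of_cover`** — LAW (v′) modulo `hcover`: for `f : a.Alb ⟶ B` over `k`, `f ≠ 0 →
  ∃ c, albDesc a (inj c) (𝒥 c) ≫ Hom.baseChange ℂ f ≠ 0`.  Proof: else `α|_{Y_c × Y_c} ≫ f_ℂ = diff_c ≫ (albDesc_c ≫ f_ℂ) =
  diff_c ≫ (albDesc_c ≫ 0_ℂ)` for all `c`, so `(α ≫ f)_ℂ = (α ≫ 0)_ℂ` on the coproduct `(∇X)_ℂ`, so `α ≫ f = α ≫ 0` (Mathlib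
  `Over.faithful_pullback`), so `f = 0` (`Albanese.hom_ext`).

With d2bridge-prove-3's `injective_of_tmul_eq_smul` ∕ `exists_pull_abelJacobi_comp_ne_zero` (p366778) and the core's
`albOnPiece_eq_abelJacobi_comp`, this is the input of the bridge's `hfaith` (injectivity of `phiStarQHom K`).  HC_CM is NOT proved.

## References
* [Liu2021] Y. Liu, arXiv:2102.11518: §2.1 Def. 2.1 (1), Def. 2.3 and the Proposition with proof (l. 1171–1208), Thm. 4.18 (1) (l. 2239).
* [GortzWedhorn2020] U. Görtz, T. Wedhorn, *Algebraic Geometry I*, 2nd ed., §(3.5) Example 3.11 (coproducts), Theorem 14.72 (1)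
  (faithfully flat descent of morphisms: base change of morphisms is faithful).
-/

set_option autoImplicit false

noncomputable section

open CategoryTheory CategoryTheory.Limits AlgebraicGeometry MonoidalCategory CartesianMonoidalCategory NumberField
open Literature.AlgebraicGeometry.Motives
open Literature.AlgebraicGeometry.HodgeTheory
open Literature.NumberTheory.Automorphic.Liu2021.AppendixC
open scoped MonObj

namespace Summit.HodgeConjecture.CorCM.D2Bridge

open AbelianVariety (bcSpec bcFunctor)

variable {k : Type} [Field k] [Algebra k ℂ] {X : SchemeOver k} (a : Albanese X)

/-! ## LAW (v′): `α` on the pieces detects every non-zero `k`-RATIONAL homomorphism out of `Alb_X`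
(restricted joint epimorphy of `albDesc`, from Def. 2.3's uniqueness OVER `k`) -/

section JointEpi

variable {κ : Type} {Yc : κ → SchemeOver ℂ} (injc : ∀ c, Yc c ⟶ (bcFunctor k ℂ).obj X)

/-- The image of `f × g` is `pr₁⁻¹(im f) ∩ pr₂⁻¹(im g)` (Mathlib `Scheme.Pullback.range_map` in `Over (Spec ℂ)`). [folklore] -/
theorem range_tensorHom_left_eq {K : Type} [Field K] {X₁ Y₁ X₂ Y₂ : SchemeOver K} (f : X₁ ⟶ X₂) (g : Y₁ ⟶ Y₂) :
    Set.range (f ⊗ₘ g).left = (fst X₂ Y₂).left ⁻¹' Set.range f.left ∩ (snd X₂ Y₂).left ⁻¹' Set.range g.left := by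
  rw [Over.tensorHom_left]
  exact Scheme.Pullback.range_map _ _ _ _ _ _ _ _ _

/-- For a leg `inj_c` of a coproduct decomposition (an open immersion), the lift `Y_c × Y_c ⟶ (∇X)_ℂ` is an OPEN IMMERSION
(`inj_c × inj_c` is one, `μ` is an isomorphism, and `(∇X ↪ X × X)_ℂ` is an open immersion). [cite: Liu2021, §2.1 Def. 2.1 (1) (l. 1171–1174)] -/
theorem isOpenImmersion_nablaLiftPiece_left (c : κ) [GeometricallyIrreducible (Yc c).hom] [IsOpenImmersion (injc c).left] :
    IsOpenImmersion (nablaLiftPiece a (injc c)).left := by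
  haveI := a.nabla.isOpenImmersion_incl
  haveI hjo := GaloisDescent.isOpenImmersion_bcFunctor_map_left ℂ a.nabla.incl
  haveI : IsIso (Functor.LaxMonoidal.μ (bcFunctor k ℂ) X X).left := by
    change IsIso ((Over.forget _).map (Functor.Monoidal.μIso (bcFunctor k ℂ) X X).hom)
    infer_instance
  haveI : IsOpenImmersion (injc c ⊗ₘ injc c).left := by
    rw [Over.tensorHom_left]
    exact MorphismProperty.pullbackMap (P := @IsOpenImmersion) ‹_› ‹_› (Over.w (injc c)).symm (Over.w (injc c)).symm
  have h1 : IsOpenImmersion ((nablaLiftPiece a (injc c)).left ≫ ((bcFunctor k ℂ).map a.nabla.incl).left) := by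
    rw [← Over.comp_left, nablaLiftPiece_incl, Over.comp_left]
    infer_instance
  exact IsOpenImmersion.of_comp _ ((bcFunctor k ℂ).map a.nabla.incl).left

/-- The first coordinate of the lift: `nablaLiftPiece ≫ (∇X ↪ X × X)_ℂ ≫ μ⁻¹ ≫ pr₁ = pr₁ ≫ inj_c`. [folklore] -/
theorem nablaLiftPiece_incl_μinv_fst (c : κ) [GeometricallyIrreducible (Yc c).hom] :
    nablaLiftPiece a (injc c) ≫ (bcFunctor k ℂ).map a.nabla.incl ≫ (Functor.Monoidal.μIso (bcFunctor k ℂ) X X).inv ≫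
        fst _ _ = fst _ _ ≫ injc c := by
  rw [← Category.assoc, nablaLiftPiece_incl, Category.assoc, Functor.Monoidal.μIso_inv, Functor.Monoidal.μ_δ_assoc,
    tensorHom_fst]

/-- The lifts of two DIFFERENT pieces of a coproduct decomposition have DISJOINT images in `(∇X)_ℂ` (their first coordinates lie in the
disjoint images of `inj_c`, `inj_d`). [cite: GortzWedhorn2020, §(3.5) Example 3.11] -/
theorem disjoint_range_nablaLiftPiece [∀ c, GeometricallyIrreducible (Yc c).hom]
    (hcol : IsColimit (Cofan.mk ((bcFunctor k ℂ).obj X) injc)) {c d : κ} (h : c ≠ d) :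
    Disjoint (Set.range ⇑(nablaLiftPiece a (injc c)).left) (Set.range ⇑(nablaLiftPiece a (injc d)).left) := by
  rw [Set.disjoint_iff]
  rintro n ⟨⟨z, hz⟩, ⟨z', hz'⟩⟩
  -- first coordinates
  set p := ((bcFunctor k ℂ).map a.nabla.incl ≫ (Functor.Monoidal.μIso (bcFunctor k ℂ) X X).inv ≫ fst _ _).left with hp
  have hc : p n ∈ Set.range ⇑(injc c).left := by
    refine ⟨(fst (Yc c) (Yc c)).left z, ?_⟩
    rw [hp, ← hz]
    simpa only [Over.comp_left, Scheme.Hom.comp_apply] using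
      (congrArg (fun φ => φ.left z) (nablaLiftPiece_incl_μinv_fst a injc c)).symm
  have hd : p n ∈ Set.range ⇑(injc d).left := by
    refine ⟨(fst (Yc d) (Yc d)).left z', ?_⟩
    rw [hp, ← hz']
    simpa only [Over.comp_left, Scheme.Hom.comp_apply] using
      (congrArg (fun φ => φ.left z') (nablaLiftPiece_incl_μinv_fst a injc d)).symm
  exact Set.disjoint_iff.mp (disjoint_range_left_of_isColimit hcol h) ⟨hc, hd⟩

/-- **The lifts `Y_c × Y_c ⟶ (∇X)_ℂ` of a coproduct decomposition that COVERS `(∇X)_ℂ` form a coproduct decomposition of `(∇X)_ℂ`**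
(open immersions, pairwise disjoint, covering: Mathlib `nonempty_isColimit_cofanMk_of`) — Liu's «`(∇X)_{k'} ≃ ∇_{k'}X' = ∐ X_i × X_i`»
read over `ℂ`, the covering being the hypothesis `hcover`. [cite: Liu2021, §2.1 proof of the Proposition (l. 1194–1200)] -/
theorem nonempty_isColimit_nablaLiftPiece [∀ c, GeometricallyIrreducible (Yc c).hom]
    (hcol : IsColimit (Cofan.mk ((bcFunctor k ℂ).obj X) injc))
    (hcover : ∀ n : ↥((bcFunctor k ℂ).obj a.nabla.N).left, ∃ (c : κ) (z : ↥(Yc c ⊗ Yc c).left),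
      (nablaLiftPiece a (injc c)).left z = n) :
    Nonempty (IsColimit (Cofan.mk ((bcFunctor k ℂ).obj a.nabla.N).left fun c => (nablaLiftPiece a (injc c)).left)) := by
  haveI := fun c => isOpenImmersion_left_of_isColimit hcol c
  haveI := fun c => isOpenImmersion_nablaLiftPiece_left a injc c
  refine nonempty_isColimit_cofanMk_of (fun c => (nablaLiftPiece a (injc c)).left) ?_ ?_
  · refine top_unique fun n _ => ?_
    obtain ⟨c, z, hz⟩ := hcover n
    exact TopologicalSpace.Opens.mem_iSup.mpr ⟨c, ⟨z, hz⟩⟩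
  · intro c d hcd
    refine disjoint_iff_inf_le.mpr fun n ⟨⟨z, hz⟩, ⟨z', hz'⟩⟩ => ?_
    exact Set.disjoint_left.mp (disjoint_range_nablaLiftPiece a injc hcol hcd) ⟨z, hz⟩ ⟨z', hz'⟩

/-- **LAW (v′) — `α` on the pieces DETECTS every non-zero `k`-rational homomorphism out of `Alb_X`** (restricted joint
epimorphy of the family `albDesc`): for a coproduct decomposition `inj_c : Y_c ⟶ X ⊗ ℂ` into geometrically irreducible pieces
whose lifts cover `(∇X)_ℂ`, Albanese data `𝒥_c` of the pieces and a NON-ZERO `k`-homomorphism `f : Alb_X → B`, some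
`albDesc a (inj c) (𝒥 c) ≫ f_ℂ` is non-zero.  PROOF (Def. 2.3 OVER `k`, no descent of abelian varieties): otherwise `α|_{Y_c × Y_c} ≫ f_ℂ = 0`
for all `c`; the lifts form a coproduct decomposition of `(∇X)_ℂ` (`nonempty_isColimit_nablaLiftPiece`), so `(α ≫ f)_ℂ = (α ≫ 0)_ℂ`,
hence `α ≫ f = α ≫ 0` (base change is faithful, Mathlib `Over.faithful_pullback`), hence `f = 0` by the UNIQUENESS clause of the
Albanese datum (`Albanese.hom_ext`, Def. 2.3 l. 1191–1192).  This is the case of the joint epimorphy that [Liu2021] Thm. 4.18 (1) uses: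
`w = f_ℂ` for `f ∈ Hom_E(A_K, A_μ)`. [cite: Liu2021, §2.1 Def. 2.3 with the Proposition (l. 1190–1208) and proof of Lemma 2.4 (1) (l. 1220–1228); Thm. 4.18 (1) (l. 2239)]
[cite: GortzWedhorn2020, Theorem 14.72 (1)] -/
theorem albDesc_comp_baseChange_ne_zero_of_cover [∀ c, GeometricallyIrreducible (Yc c).hom]
    (hcol : IsColimit (Cofan.mk ((bcFunctor k ℂ).obj X) injc)) (𝒥 : ∀ c, Jacobian (Yc c))
    (hcover : ∀ n : ↥((bcFunctor k ℂ).obj a.nabla.N).left, ∃ (c : κ) (z : ↥(Yc c ⊗ Yc c).left),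
      (nablaLiftPiece a (injc c)).left z = n)
    {B : AbelianVariety k} {f : a.Alb ⟶ B} (hf : f ≠ 0) :
    ∃ c, albDesc a (injc c) (𝒥 c) ≫ AbelianVariety.Hom.baseChange ℂ f ≠ 0 := by
  by_contra hall
  push Not at hall
  apply hf
  -- it suffices that `α ≫ f = α ≫ 0` (Def. 2.3 uniqueness over `k`), and for that, after base change (faithful)
  apply a.hom_ext
  apply (bcFunctor k ℂ).map_injective
  -- both sides agree on every piece `Y_c × Y_c` of the coproduct decomposition of `(∇X)_ℂ`
  obtain ⟨hN⟩ := nonempty_isColimit_nablaLiftPiece a injc hcol hcover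
  apply Over.OverMorphism.ext
  refine Cofan.IsColimit.hom_ext hN _ _ fun c => ?_
  change (nablaLiftPiece a (injc c)).left ≫ ((bcFunctor k ℂ).map (a.α ≫ f.hom.hom.hom)).left =
    (nablaLiftPiece a (injc c)).left ≫ ((bcFunctor k ℂ).map (a.α ≫ (0 : a.Alb ⟶ B).hom.hom.hom)).left
  rw [← Over.comp_left, ← Over.comp_left]
  congr 1
  -- both sides are `diff ≫ (albDesc ≫ g_ℂ)` for `g = f`, resp. `g = 0`, and `albDesc ≫ f_ℂ = 0 = albDesc ≫ 0_ℂ`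
  have key : ∀ g : a.Alb ⟶ B, nablaLiftPiece a (injc c) ≫ (bcFunctor k ℂ).map (a.α ≫ g.hom.hom.hom) =
      (𝒥 c).diff ≫ (albDesc a (injc c) (𝒥 c) ≫ AbelianVariety.Hom.baseChange ℂ g).hom.hom.hom := by
    intro g
    rw [Functor.map_comp, ← Category.assoc]
    change albPair a (injc c) ≫ (AbelianVariety.Hom.baseChange ℂ g).hom.hom.hom = _
    rw [← diff_albDesc a (injc c) (𝒥 c), Category.assoc]
    rfl
  rw [key f, key 0, hall c, AbelianVariety.Hom.baseChange_zero, Limits.comp_zero]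

end JointEpi

end Summit.HodgeConjecture.CorCM.D2Bridge

end
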